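import Literature.AnabelianGeometry.EtaleTheta.Discharge.Sec1Thm16iiPsiUnique
import HarnessLib

/-!
# [EtTh] Thm. 1.6 (ii) for Kummer cores: the cyclotomic-rigidity junction `hΘι` (universal form) HOLDS at the SELF-PAIR
# (`γ = id`), so the hypotheses of `KummerCore.thm16ii_toKummerData_of_cyclotomicRigidity` are jointly satisfiable at every core
# with open augmentation (non-vacuity; proof-only)

S. Mochizuki, *The étale theta function …*, Publ. RIMS **45** (2009), §1, Thm. 1.6 (ii) p. 24 [cite: MochizukiEtTh2009, Thm 1.6 (ii) p.24].
Layer L2 of the abc-iut cell, seat abc-iut-L2-t1 (gen 12; NV sequel of abc-iut-L2-lead R1288/R1298). PROOF-ONLY over this seat's FILE 2–4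
(`hV_of_unitsTransport`, `psi_unique`) and `TemperedRigidityValuation` (`ThetaCompanion.thetaIso_apply_of_refl`, `thm16i_refl`) — BY NAME.

At `α = β`, `γ = id`, `αG = id`: the UNIQUE `γ`-equivariant uniformiser-preserving `ψ : ℚ̄_p^× →̃ ℚ̄_p^×` (abc-iut-L4 / FILE 4 `psi_unique`) is the
identity (`KummerCore.psi_eq_refl_of_self`), so the universal junction `hΘι` reduces to `c.thetaIso ∘ coeffHom = coeffHom`, which holds for
every companion `c` of `id` (`thetaIso_apply_of_refl`): `KummerCore.cyclotomeCompat_forall_self`. Hence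
`KummerCore.thm16ii_toKummerData_self_of_isOpenMap` — the general closer APPLIED at the self-pair from {Compat, Prop15ii, IsOpenMap aug} —
agreeing with the unconditional `thm16ii_refl`; the point is the NON-VACUITY of the junction hypothesis (a consistency check, model ≠ genuine
curve is not even needed here: any core). HONEST FRAMING: nothing of [EtTh] is asserted; no side is taken on [IUTchIII] Cor. 3.12; typed ≠ proved.
-/

noncomputable section

namespace Literature.AnabelianGeometry.EtaleTheta

open Literature.AnabelianGeometry.SemiGraphs

namespace ThetaSetting.KummerCore

variable {p : ℕ} [Fact p.Prime] {D : ThetaSetting p}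

/-- At the self-pair the [AbsAnab] 1.2.1 (vii) transport is the identity: any `ψ` that is `id`-equivariant on `Π^tp_Ÿ` and carries
norm-uniformisers of `K̈` to norm-uniformisers of `K̈` equals `MulEquiv.refl` (`psi_unique` with `αG = id`).
[cite: MochizukiAbsAnab2004, Prop 1.2.1 (vii) p.11] -/
theorem psi_eq_refl_of_self (C : D.KummerCore) {ψ : (PadicAlgCl p)ˣ ≃* (PadicAlgCl p)ˣ}
    (hψG : ∀ y ∈ D.GtpYdd, ∀ x : (PadicAlgCl p)ˣ, ψ (D.aug y • x) = D.aug ((ContinuousMulEquiv.refl D.PiTemp) y) • ψ x)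
    (hψϖ : ∀ ϖ : (↥D.Kdd)ˣ, IsUniformizer D ϖ → ∃ ϖ' : (↥D.Kdd)ˣ, IsUniformizer D ϖ' ∧
      (ψ (Units.map (algebraMap (↥D.Kdd) (PadicAlgCl p) : ↥D.Kdd →* PadicAlgCl p) ϖ) : PadicAlgCl p) =
        ((ϖ' : ↥D.Kdd) : PadicAlgCl p)) :
    ψ = MulEquiv.refl _ :=
  psi_unique (γ := ContinuousMulEquiv.refl D.PiTemp) (ψ := MulEquiv.refl _) (ψ' := ψ) C C (ContinuousMulEquiv.refl _)
    (fun _ _ => rfl) (fun _ _ _ => rfl) hψG (fun ϖ hϖ => ⟨ϖ, hϖ, rfl⟩) hψϖ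

/-- **The cyclotomic-rigidity junction (universal form) HOLDS at the self-pair** for every companion `c` of `γ = id`: the unique transport
is `ψ = id`, `Λ(id) = id`, and `c.thetaIso = id`. [cite: MochizukiEtTh2009, Thm 1.6 (ii) p.24] -/
theorem cyclotomeCompat_forall_self (C : D.KummerCore) (c : ThetaCompanion (ContinuousMulEquiv.refl D.PiTemp)) :
    ∀ ψ : (PadicAlgCl p)ˣ ≃* (PadicAlgCl p)ˣ,
      (∀ y ∈ D.GtpYdd, ∀ x : (PadicAlgCl p)ˣ, ψ (D.aug y • x) = D.aug ((ContinuousMulEquiv.refl D.PiTemp) y) • ψ x) →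
      (∀ x : (PadicAlgCl p)ˣ, ‖(x : PadicAlgCl p)‖ = 1 ↔ ‖(ψ x : PadicAlgCl p)‖ = 1) →
      (∀ ϖ : (↥D.Kdd)ˣ, IsUniformizer D ϖ → ∃ ϖ' : (↥D.Kdd)ˣ, IsUniformizer D ϖ' ∧
        (ψ (Units.map (algebraMap (↥D.Kdd) (PadicAlgCl p) : ↥D.Kdd →* PadicAlgCl p) ϖ) : PadicAlgCl p) =
          ((ϖ' : ↥D.Kdd) : PadicAlgCl p)) →
      ∀ ζ : cyclotome (PadicAlgCl p)ˣ,
        c.thetaIso (C.coeffHom ζ : D.GtpTheta) =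
          (C.coeffHom (cyclotome.map (ψ : (PadicAlgCl p)ˣ →* (PadicAlgCl p)ˣ) ζ) : D.GtpTheta) := by
  intro ψ hψG _ hψϖ ζ
  rw [psi_eq_refl_of_self C hψG hψϖ, c.thetaIso_apply_of_refl]
  rfl

/-- **NON-VACUITY of the closer's hypotheses**: at every Kummer core with `Compat`, Prop. 1.5 (ii) and an open augmentation, the general
closer `thm16ii_toKummerData_of_cyclotomicRigidity` APPLIES at the self-pair (`γ = id`, `hΔ` trivial, `hΘι` by `cyclotomeCompat_forall_self`),
recovering `Thm16ii id` for `C.toKummerData` with its canonical valuation data (cf. the unconditional `thm16ii_refl`).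
[cite: MochizukiEtTh2009, Thm 1.6 (ii) p.24] -/
theorem thm16ii_toKummerData_self_of_isOpenMap (C : D.KummerCore) (hC : D.Compat) (h15 : Prop15ii C.toKummerData hC)
    (haug : IsOpenMap D.aug) :
    Thm16ii (ContinuousMulEquiv.refl D.PiTemp) (thm16i_refl D) C.toKummerData C.toKummerData
      (ValuationHatData.canonical C.toKummerData) (ValuationHatData.canonical C.toKummerData) :=
  thm16ii_toKummerData_of_cyclotomicRigidity (ThetaCompanion.ofRefl D) (thm16i_refl D) (Subgroup.map_id _) C C hC hC h15 h15
    haug haug (cyclotomeCompat_forall_self C (ThetaCompanion.ofRefl D))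

end ThetaSetting.KummerCore

end Literature.AnabelianGeometry.EtaleTheta

end
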